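import Literature.Computability.Complexity.EasyWitnessGenerator
import Literature.Computability.Complexity.CircuitEval
import Literature.Computability.Complexity.ExpTimeMaps
import Literature.Computability.Complexity.FoldBricks
import Literature.Computability.Complexity.PlumbingBricks
import Literature.Computability.Complexity.FinitePatching
import Literature.Computability.Complexity.StackWordArith
import Literature.Computability.Complexity.KannanLanguage
import Literature.Computability.MetaComplexity.TruthTablesProofs
import HarnessLib

/-!
# The easy-witness search (IKW 2002, Lemma 17 / Thm. 18, the `EXP` half) and
# `IKW2002_thm18_MA` from `IKW2002_thm12_2`

Literature / circuit complexity, sequel of `EasyWitnessGenerator.lean` (serves the leaf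
`IKW2002_thm18_MA` of `EasyWitness.lean` under the named fact `NEXP_eq_EXP_of_subset_PPoly`,
`ExpTimeCollapses.lean`). Impagliazzo–Kabanets–Wigderson, §3.1: for a relation `R(x, y)` on
`{0,1}ⁿ × {0,1}^{2ⁿ}` let `f̂_{R,A,s}(x) = 1` iff some `y` of `A`-oracle circuit complexity `≤ s(n)`
(viewed as the truth table of a `log|y|`-variable function) has `R(x, y)`; "if `s(n) ∈ poly(n)`,
then the function `f̂_{R,A,s}` is computable in deterministic time `2^{poly(n)}`" (enumerate the
circuits), so "if `f_R = f̂_{R,A,s}`, then we get a nontrivial deterministic algorithm for computing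
`f_R`"; Lemma 17 is the other case, and the proof of Thm. 18 combines: "it follows by a simple
padding argument that if for every … `R` … there is a `d ∈ ℕ` such that `f_R = f̂_{R,SAT,n^d}`, then
`NEXP ⊆ EXP`. Hence, our assumption that `NEXP ≠ EXP` implies, by Lemma 17, [a generator]; the
claim now follows by Theorem 13 (statement 2)" — here with the empty oracle and Thm. 12 (2), the
`MA` case used by Thm. 24 (Arora–Barak, proof of Lemma 20.20). This file formalizes that `EXP`
half over the tree's machines and closes the argument:

* `EasyWitness.row`, `EasyWitness.ttOf m d` — the table of an ARBITRARY description `d` at `m`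
  variables: the answers of the tree's total circuit evaluator `CircEval.evalFn` (`CircuitEval.lean`)
  on the rows `⟨bits of i, d⟩`, `i < 2ᵐ`; for the description `desc C` of a `B₂`-circuit this is
  `truthTable C.eval` (`ttOf_desc`: the row order is that of `MetaComplexity.boolFunEquivFin`,
  `boolFunEquivFin_symm_apply`), whence `D`-easy inputs (`EasyWitness.Easy`) have certificates of
  length `≤ (m^D+1)(8(m+m^D)+10)` (`exists_desc_of_easy`, by `exists_computes_B2_size_eq_holds` and
  `CircEval.length_desc_le`) — no decoding or validity check of descriptions is ever needed;
* `EasyWitness.ttFn ∈ FP` — the table as a counted fold (`Brick.foldLoop` with concatenation,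
  `FoldBricks.lean`) over the rows (`rowFn`: `(bin i ++ 0ᵐ) ↾ m`), given an input at least `2ᵐ` long;
* `EasyWitness.SearchLang C R S ∈ P` (`searchLang_mem_P`) — on `⟨u, ⟨x, d⟩⟩`: the yardstick `u` is
  long enough (`2ᵐ ≤ |u|`, tested as `m < |bin |u||`) and the payload `unpad (ttOf m d)` is accepted
  by the total verifier (consulted under `mapFstAux` only under that guard, so that its time
  `C·2^{|x|} + C + 2ᵐ` is linear), or `x` lies in a finite patch `S` of short words
  (`mem_FP_of_eqOn_le`); `EasyWitness.EasyLang C R S D ∈ EXP` (`easyLang_mem_EXP`) — a polynomially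
  bounded `∃` (`polyExists_EXP_subset_EXP`) over the `lpad`-preimage (`preimage_mem_EXP`,
  `lpad_mem_FE`, `ExpTimeMaps.lean`) of the search language;
* **`mem_EXP_of_eventually_easy`** / **`frequently_not_easy_of_not_mem_EXP`** — if all long
  accepted inputs are `D`-easy then `L ∈ EXP`; so `L ∉ EXP` forces, for every `D`, non-`D`-easy
  accepted inputs at infinitely many lengths (the hypothesis of `hardIO_of_frequently_not_easy`);
* **`IKW2002_thm18_MA_of_thm12_2 : IKW2002_thm12_2 → IKW2002_thm18_MA`** — pick
  `L ∈ NEXP ∖ EXP`, pad it into `NTIME(2ⁿ)` (`padPre_mem_NTIME_two_pow`, `karpReducible_padPre`,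
  `mem_EXP_of_karpReducible`), take its total verifier (`NTIMEWindow.lean`) and combine the two
  halves. After this file the trust base of `NEXP_eq_EXP_of_subset_PPoly` is
  {`EXP_eq_MA_of_subset_PPoly`, `IKW2002_thm12_2`} (see `EasyWitnessUniversalProofs.lean`).

Nothing is asserted (no `def … : Prop`); Mathlib has none of these notions; nothing duplicates the
tree (searched `ttOf`, `truth table of a description`, `easy witness`, `thm18_MA_of`).

## References

* R. Impagliazzo, V. Kabanets, A. Wigderson, *In search of an easy witness: exponential time vs.
  probabilistic polynomial time*, J. Comput. System Sci. 65 (2002) 672–694, §3.1 (the functions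
  `f_R`, `f̂_{R,A,s}`; Lemma 17; Thm. 18 and its proof), Thm. 12 (2)
  [ImpagliazzoKabanetsWigderson2002] (text checked: held JCSS author version
  `paper:doi-10-1016-s0022-0000-02-00024-7`, pp. 9–10).
* S. Arora, B. Barak, *Computational Complexity: A Modern Approach*, CUP 2009, proof of
  Lemma 20.20 (p. 417), Claim 2.4 (exhaustive search in exponential time), Thm. 6.18 (circuit
  evaluation in polynomial time), §1.3 [AroraBarakCC2009].
* V. Kabanets, J.-Y. Cai, *Circuit minimization problem*, STOC 2000, §2 (truth tables as
  strings, the row order) [KabanetsCai2000].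
-/

namespace Literature.Computability.Complexity

open _root_.Computability Turing Polynomial Filter

namespace EasyWitness

/-! ### Rows of a truth table and the table of a circuit description -/

section Rows

/-- Row `i` of an `m`-variable truth table: the assignment `j ↦ bit j of i` (least significant
bit first, the order of `MetaComplexity.boolFunEquivFin`), as an `m`-bit word. [folklore] -/
def row (m i : ℕ) : List Bool := List.ofFn fun j : Fin m => i.testBit j

/-- A row has `m` bits. [folklore] -/
@[simp] theorem length_row (m i : ℕ) : (row m i).length = m := by simp [row]

/-- The bits of the numeral `encodeNat i` are the binary digits of `i`. [folklore] -/
theorem getD_encodeNat (i j : ℕ) : (encodeNat i).getD j false = i.testBit j := by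
  have h := Com.testBit_bitsToNat (encodeNat i) j
  rw [bitsToNat_encodeNat] at h
  exact h.symm

/-- **The row word from the numeral**: `(bin i ++ 0ᵐ) ↾ m = row m i`. [folklore] -/
theorem take_encodeNat_append (m i : ℕ) :
    (encodeNat i ++ List.replicate m false).take m = row m i := by
  apply List.ext_getElem
  · simp
  · intro n h1 h2
    rw [length_row] at h2
    rw [List.getElem_take]
    simp only [row, List.getElem_ofFn]
    rw [← getD_encodeNat]
    by_cases h : n < (encodeNat i).length
    · rw [List.getElem_append_left h, List.getD_eq_getElem _ _ h]
    · push Not at h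
      rw [List.getElem_append_right h, List.getElem_replicate, List.getD_eq_default _ _ h]

/-- The assignment enumerated as number `i` is row `i`: the inverse of `boolFunEquivFin` reads off
the binary digits. [cite: KabanetsCai2000, §2] -/
theorem boolFunEquivFin_symm_apply {m : ℕ} (i : Fin (2 ^ m)) (j : Fin m) :
    (MetaComplexity.boolFunEquivFin m).symm i j = (i : ℕ).testBit j := by
  have hx : ((finFunctionFinEquiv.symm i) j : ℕ) = i / 2 ^ (j : ℕ) % 2 :=
    finFunctionFinEquiv_symm_apply_val i j
  simp only [MetaComplexity.boolFunEquivFin, Equiv.arrowCongr, finTwoEquiv,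
    Nat.testBit_eq_decide_div_mod_eq, Equiv.symm_trans_apply, Equiv.coe_fn_symm_mk,
    Equiv.refl_symm, Equiv.coe_refl, Function.comp_apply, id, Equiv.symm_symm, Equiv.coe_fn_mk]
  rw [← hx]
  generalize finFunctionFinEquiv.symm i j = x
  fin_cases x <;> rfl

variable {m : ℕ}

/-- Gates of a `B₂`-circuit have arity `≤ 2`. [folklore] -/
theorem arity_le_two_of_isOver {C : Circuit (Fin m)} (hC : C.IsOver B2) :
    ∀ g ∈ C.gates, g.arity ≤ 2 := fun g hg => hC g hg

/-- The circuit evaluator on `⟨w, desc C⟩` for a word `w` of length `m` (the length cast made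
explicit; `CircEval.evalFn_boolPair_desc`). [cite: AroraBarakCC2009, Thm. 6.18 (proof)] -/
theorem evalFn_boolPair_desc_cast (C : Circuit (Fin m)) (hC : ∀ g ∈ C.gates, g.arity ≤ 2)
    (w : List Bool) (hw : w.length = m) :
    CircEval.evalFn (boolPair w (CircEval.desc C)) = [C.eval fun j => w.get (j.cast hw.symm)] := by
  subst hw
  exact CircEval.evalFn_boolPair_desc w C hC

/-- **The evaluator on a row**: `evalFn ⟨row m i, desc C⟩ = [C(bits of i)]`.
[cite: AroraBarakCC2009, Thm. 6.18 (proof)] -/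
theorem evalFn_row_desc (C : Circuit (Fin m)) (hC : C.IsOver B2) (i : ℕ) :
    CircEval.evalFn (boolPair (row m i) (CircEval.desc C)) = [C.eval fun j => i.testBit j] := by
  rw [evalFn_boolPair_desc_cast C (arity_le_two_of_isOver hC) (row m i) (length_row m i)]
  have e : (fun j : Fin m => (row m i).get (j.cast (length_row m i).symm)) =
      fun j : Fin m => i.testBit j := by
    funext j; simp [row]
  rw [e]

/-- **The table of a description** `d` at `m` variables: the concatenation of the evaluator's
answers `evalFn ⟨row m i, d⟩` over `i < 2ᵐ` (one bit each, whatever `d` is). [folklore] -/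
def ttOf (m : ℕ) (d : List Bool) : List Bool :=
  ccat (fun i => CircEval.evalFn (boolPair (row m i) d)) (2 ^ m)

/-- A concatenation of single bits is a map. [folklore] -/
theorem ccat_singleton (b : ℕ → Bool) (k : ℕ) : ccat (fun j => [b j]) k = (List.range k).map b := by
  induction k with
  | zero => rfl
  | succ k ih => rw [ccat_succ, ih, List.range_succ, List.map_append, List.map_singleton]

/-- The evaluator's answer as a bit. [folklore] -/
theorem evalFn_eq_singleton (z : List Bool) :
    CircEval.evalFn z = [(CircEval.evalFn z).headD false] := by
  rcases CircEval.evalFn_eq_or z with h | h <;> rw [h] <;> rfl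

/-- The table of a description is a map over the rows. [folklore] -/
theorem ttOf_eq_map (m : ℕ) (d : List Bool) :
    ttOf m d = (List.range (2 ^ m)).map fun i => (CircEval.evalFn (boolPair (row m i) d)).headD false := by
  have e : (fun i => CircEval.evalFn (boolPair (row m i) d)) =
      fun i => [(CircEval.evalFn (boolPair (row m i) d)).headD false] :=
    funext fun i => evalFn_eq_singleton _
  rw [ttOf, e, ccat_singleton]

/-- A table has `2ᵐ` bits. [folklore] -/
@[simp] theorem length_ttOf (m : ℕ) (d : List Bool) : (ttOf m d).length = 2 ^ m := by
  rw [ttOf_eq_map]; simp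

/-- **The table of the description of a `B₂`-circuit is its truth table.**
[cite: AroraBarakCC2009, Thm. 6.18 (proof)] [cite: KabanetsCai2000, §2] -/
theorem ttOf_desc (C : Circuit (Fin m)) (hC : C.IsOver B2) :
    ttOf m (CircEval.desc C) = MetaComplexity.truthTable C.eval := by
  rw [ttOf_eq_map]
  simp only [evalFn_row_desc C hC, List.headD_cons]
  apply List.ext_getElem
  · simp [MetaComplexity.truthTable]
  · intro n h1 h2
    simp only [List.getElem_map, List.getElem_range, MetaComplexity.truthTable, List.getElem_ofFn]
    congr 1
    funext j
    rw [boolFunEquivFin_symm_apply]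

/-- **Easy inputs have short certificates**: if `x` is `D`-easy at `m` variables then some
description `d` of length `≤ (m^D + 1)(8(m + m^D) + 10)` has a table whose payload is an accepted
witness (`MetaComplexity.exists_computes_B2_size_eq_holds`: the circuit complexity is attained;
`CircEval.length_desc_le`). [cite: ImpagliazzoKabanetsWigderson2002, §3.1] -/
theorem exists_desc_of_easy {R : List Bool → List Bool → Bool} {D m : ℕ} {x : List Bool}
    (h : Easy R D m x) :
    ∃ d : List Bool, d.length ≤ (m ^ D + 1) * (8 * (m + m ^ D) + 10) ∧
      R x (unpad (ttOf m d)) = true := by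
  obtain ⟨f, hf, hR⟩ := h
  obtain ⟨C, hB, hCf, hsize⟩ := MetaComplexity.exists_computes_B2_size_eq_holds f
  have he : C.eval = f := funext hCf
  refine ⟨CircEval.desc C, (CircEval.length_desc_le C).trans ?_, by rwa [ttOf_desc C hB, he]⟩
  rw [hsize]
  have h1 : circuitSizeOver B2 f + 1 ≤ m ^ D + 1 := by omega
  exact Nat.mul_le_mul h1 (by omega)

end Rows

/-! ### Computing the table of a description in `FP` (given a long enough yardstick) -/

section TableFn

/-- The body of `rowFn`: `⟨u, v⟩ ↦ bin |v| ++ 0^{|u|}`. [folklore] -/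
noncomputable def rowBody (z : List Bool) : List Bool :=
  Brick.lenBinF (Brick.sndF z) ++ Kannan.zerosFn (Brick.fstF z)

/-- `lenBinF ∘ sndF ∈ FP`. [folklore] -/
theorem lenBinF_sndF_mem_FP : (Brick.lenBinF ∘ Brick.sndF) ∈ FP :=
  comp_mem_FP Brick.lenBinF_mem_FP Brick.sndF_mem_FP

/-- `zerosFn ∘ fstF ∈ FP`. [folklore] -/
theorem zerosFn_fstF_mem_FP : (Kannan.zerosFn ∘ Brick.fstF) ∈ FP :=
  comp_mem_FP Kannan.zerosFn_mem_FP Brick.fstF_mem_FP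

/-- `rowBody ∈ FP`. [folklore] -/
theorem rowBody_mem_FP : rowBody ∈ FP := append_mem_FP lenBinF_sndF_mem_FP zerosFn_fstF_mem_FP

/-- `rowFn ⟨1ᵐ, 1ⁱ⟩ = row m i` (`(bin i ++ 0ᵐ) ↾ m`: `lenBinF`, `zerosFn`, `takeFn`). [folklore] -/
noncomputable def rowFn : List Bool → List Bool :=
  Plumb.takeFn ∘ fanoutFn Brick.fstF rowBody

/-- `rowFn ∈ FP`. [folklore] -/
theorem rowFn_mem_FP : rowFn ∈ FP :=
  comp_mem_FP Plumb.takeFn_mem_FP (fanoutFn_mem_FP Brick.fstF_mem_FP rowBody_mem_FP)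

/-- Value of `rowFn`. [folklore] -/
theorem rowFn_apply (m i : ℕ) : rowFn (boolPair (ones m) (ones i)) = row m i := by
  simp only [rowFn, rowBody, Function.comp_apply, fanoutFn_apply, Brick.fstF_boolPair,
    Brick.sndF_boolPair, Brick.lenBinF_apply, Kannan.zerosFn_apply, Plumb.takeFn_boolPair, ones,
    List.length_replicate]
  exact take_encodeNat_append m i

/-- The piece function of the table fold: on `⟨X, 1ⁱ⟩` with context `X = ⟨yard, ⟨1ᵐ, d⟩⟩`, the
evaluator's answer on row `i`. [folklore] -/
noncomputable def pieceF : List Bool → List Bool :=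
  CircEval.evalFn ∘ fanoutFn (rowFn ∘ fanoutFn (Brick.nthF 1 ∘ Brick.fstF) Brick.sndF)
    (Brick.sndPow 1 ∘ Brick.fstF)

/-- `pieceF ∈ FP`. [folklore] -/
theorem pieceF_mem_FP : pieceF ∈ FP :=
  comp_mem_FP CircEval.evalFn_mem_FP (fanoutFn_mem_FP
    (comp_mem_FP rowFn_mem_FP (fanoutFn_mem_FP (comp_mem_FP (Brick.nthF_mem_FP 1) Brick.fstF_mem_FP)
      Brick.sndF_mem_FP))
    (comp_mem_FP (Brick.sndPow_mem_FP 1) Brick.fstF_mem_FP))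

/-- Value of the piece function. [folklore] -/
theorem pieceF_apply (yard d : List Bool) (m i : ℕ) :
    pieceF (boolPair (boolPair yard (boolPair (ones m) d)) (ones i)) =
      CircEval.evalFn (boolPair (row m i) d) := by
  simp only [pieceF, Function.comp_apply, fanoutFn_apply, Brick.fstF_boolPair, Brick.sndF_boolPair,
    Brick.nthF_succ_boolPair, Brick.nthF_zero_boolPair, Brick.sndPow_succ_boolPair,
    Brick.sndPow_zero_boolPair, rowFn_apply]

/-- The evaluator emits one bit. [folklore] -/
theorem length_evalFn (z : List Bool) : (CircEval.evalFn z).length = 1 := by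
  rcases CircEval.evalFn_eq_or z with h | h <;> rw [h] <;> rfl

/-- The piece function emits one bit. [folklore] -/
theorem length_pieceF (w : List Bool) : (pieceF w).length = 1 := length_evalFn _

/-- The growth bound of the piece function, in the shape `foldLoop_mem_FP` asks for. [folklore] -/
theorem length_pieceF_le (w : List Bool) : (pieceF w).length ≤ 1 * ((Brick.fstF w).length + 1) := by
  rw [length_pieceF]; omega

/-- The fold's initial record `X ↦ ⟨X, ⟨bin 2ᵐ, ⟨ε, ε⟩⟩⟩` (`bin 2ᵐ = 0ᵐ1` from the field `1ᵐ`).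
[folklore] -/
noncomputable def foldInF : List Bool → List Bool :=
  fanoutFn (fun w => w) (fanoutFn (fun X => Kannan.zerosFn (Brick.nthF 1 X) ++ [true])
    (fun _ => boolPair [] []))

/-- `zerosFn ∘ nthF 1 ∈ FP`. [folklore] -/
theorem zerosFn_nthF_mem_FP : (Kannan.zerosFn ∘ Brick.nthF 1) ∈ FP :=
  comp_mem_FP Kannan.zerosFn_mem_FP (Brick.nthF_mem_FP 1)

/-- The countdown field `X ↦ 0ᵐ1` is in `FP`. [folklore] -/
theorem cntF_mem_FP : (fun X => Kannan.zerosFn (Brick.nthF 1 X) ++ [true]) ∈ FP :=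
  append_mem_FP zerosFn_nthF_mem_FP (const_mem_FP [true])

/-- `foldInF ∈ FP`. [folklore] -/
theorem foldInF_mem_FP : foldInF ∈ FP :=
  fanoutFn_mem_FP OracleCompose.id_mem_FP (fanoutFn_mem_FP cntF_mem_FP (const_mem_FP _))

/-- Value of `foldInF`. [folklore] -/
theorem foldInF_apply (yard d : List Bool) (m : ℕ) :
    foldInF (boolPair yard (boolPair (ones m) d)) =
      boolPair (boolPair yard (boolPair (ones m) d))
        (boolPair (encodeNat (2 ^ m)) (boolPair (ones 0) [])) := by
  simp only [foldInF, fanoutFn_apply, Brick.nthF_succ_boolPair,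
    Brick.nthF_zero_boolPair, Kannan.zerosFn_apply, ones, List.length_replicate,
    Com.encodeNat_two_pow, List.replicate_zero]

/-- **The table function** `⟨yard, ⟨1ᵐ, d⟩⟩ ↦ ttOf m d`: the counted fold
(`Brick.foldLoop`, concatenating the pieces) run for `2ᵐ ≤ |input|` rounds, then the projection to
the accumulator. [cite: AroraBarakCC2009, §1.3 (bounded loops)] -/
noncomputable def ttFn : List Bool → List Bool :=
  Brick.sndPow 2 ∘ Brick.foldLoop Brick.appF pieceF X ∘ foldInF

/-- **`ttFn ∈ FP`.** [cite: AroraBarakCC2009, §1.3] -/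
theorem ttFn_mem_FP : ttFn ∈ FP :=
  comp_mem_FP (Brick.sndPow_mem_FP 2) (comp_mem_FP
    (Brick.foldLoop_mem_FP Brick.appF_mem_FP Brick.length_appF_le pieceF_mem_FP length_pieceF_le X)
    foldInF_mem_FP)

/-- **Value of the table function** when the input is at least `2ᵐ` long.
[cite: AroraBarakCC2009, §1.3] -/
theorem ttFn_apply (yard d : List Bool) (m : ℕ)
    (h : 2 ^ m ≤ (boolPair yard (boolPair (ones m) d)).length) :
    ttFn (boolPair yard (boolPair (ones m) d)) = ttOf m d := by
  simp only [ttFn, Function.comp_apply, foldInF_apply]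
  rw [Brick.foldLoop_apply _ _ (by simpa only [eval_X] using h) 0 []]
  simp only [Brick.sndPow_succ_boolPair, Brick.sndPow_zero_boolPair, Brick.foldAcc_appF,
    List.nil_append, zero_add, pieceF_apply]
  rfl

end TableFn

/-! ### The search language of one exponent (the `EXP` brute force of easy witnesses) -/

section Search

variable (C : ℕ) (R : List Bool → List Bool → Bool) (S : Set (List Bool))

/-- **The search language** (polynomial-time layer): words `⟨u, ⟨x, d⟩⟩` such that EITHER the
yardstick `u` is long enough (`2ᵐ ≤ |u|`, `m = |x| + C + 1`) and the payload of the table of the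
description `d` at `m` variables is an accepted witness of `x`, OR `x` lies in the finite patch
`S`. [cite: ImpagliazzoKabanetsWigderson2002, §3.1 (the algorithm for `f̂_{R,A,s}`)] -/
def SearchLang : Language Bool :=
  {z | (2 ^ ((Brick.fstF (Brick.sndF z)).length + (C + 1)) ≤ (Brick.fstF z).length ∧
      R (Brick.fstF (Brick.sndF z))
        (unpad (ttOf ((Brick.fstF (Brick.sndF z)).length + (C + 1)) (Brick.sndF (Brick.sndF z)))) = true) ∨
    Brick.fstF (Brick.sndF z) ∈ S}

variable {C R S} in
/-- Membership in the search language (definitional). [folklore] -/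
theorem mem_searchLang_iff (z : List Bool) :
    z ∈ SearchLang C R S ↔
      (2 ^ ((Brick.fstF (Brick.sndF z)).length + (C + 1)) ≤ (Brick.fstF z).length ∧
        R (Brick.fstF (Brick.sndF z))
          (unpad (ttOf ((Brick.fstF (Brick.sndF z)).length + (C + 1)) (Brick.sndF (Brick.sndF z)))) = true) ∨
      Brick.fstF (Brick.sndF z) ∈ S :=
  Iff.rfl

/-- Field `u` (the yardstick). [folklore] -/
def uA : List Bool → List Bool := Brick.fstF
/-- Field `x` (the input). [folklore] -/
def xA : List Bool → List Bool := Brick.fstF ∘ Brick.sndF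
/-- Field `d` (the description). [folklore] -/
def dA : List Bool → List Bool := Brick.sndF ∘ Brick.sndF
/-- `1ᵐ`, `m = |x| + C + 1`. [folklore] -/
def mA (C : ℕ) : List Bool → List Bool := fun z => onesFn (xA z) ++ ones (C + 1)
/-- The guard `[2ᵐ ≤ |u|]`, as `[m < |bin |u||]`. [folklore] -/
noncomputable def gA (C : ℕ) : List Bool → List Bool :=
  Brick.ltLenF ∘ fanoutFn (mA C) (Brick.lenBinF ∘ uA)
/-- The table function's input `⟨u, ⟨1ᵐ, d⟩⟩`. [folklore] -/
noncomputable def XA (C : ℕ) : List Bool → List Bool := fanoutFn uA (fanoutFn (mA C) dA)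
/-- The candidate witness `unpad (ttOf m d)` (computed only under the guard). [folklore] -/
noncomputable def yA (C : ℕ) : List Bool → List Bool := unpad ∘ ttFn ∘ XA C
/-- The verifier's input: `⟨x, y⟩` under the guard, else the dummy `⟨ε, ε⟩`. [folklore] -/
noncomputable def vinA (C : ℕ) : List Bool → List Bool :=
  iteFn (gA C) (fanoutFn xA (yA C)) (fun _ => boolPair [] [])
/-- The patch bit `[x ∈ S]`. [folklore] -/
noncomputable def sA (S : Set (List Bool)) : List Bool → List Bool := fun z => [S.boolIndicator (xA z)]
/-- The preparation `z ↦ ⟨vin, ⟨g, s⟩⟩`. [folklore] -/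
noncomputable def preA (C : ℕ) (S : Set (List Bool)) : List Bool → List Bool :=
  fanoutFn (vinA C) (fanoutFn (gA C) (sA S))
/-- The read-out `⟨[r], ⟨[g], [s]⟩⟩ ↦ [s ∨ (g ∧ r)]`. [folklore] -/
noncomputable def postA : List Bool → List Bool :=
  iteFn (Brick.sndF ∘ Brick.sndF) (fun _ => [true]) (Brick.andFn (Brick.fstF ∘ Brick.sndF) Brick.fstF)

variable {C R S}

/-- `xA ∈ FP`. [folklore] -/
theorem xA_mem_FP : xA ∈ FP := comp_mem_FP Brick.fstF_mem_FP Brick.sndF_mem_FP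
/-- `dA ∈ FP`. [folklore] -/
theorem dA_mem_FP : dA ∈ FP := comp_mem_FP Brick.sndF_mem_FP Brick.sndF_mem_FP
/-- `onesFn ∘ xA ∈ FP`. [folklore] -/
theorem onesFn_xA_mem_FP : (onesFn ∘ xA) ∈ FP := comp_mem_FP onesFn_mem_FP xA_mem_FP
/-- `mA C ∈ FP`. [folklore] -/
theorem mA_mem_FP (C : ℕ) : mA C ∈ FP := append_mem_FP onesFn_xA_mem_FP (const_mem_FP _)
/-- `lenBinF ∘ uA ∈ FP`. [folklore] -/
theorem lenBinF_uA_mem_FP : (Brick.lenBinF ∘ uA) ∈ FP :=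
  comp_mem_FP Brick.lenBinF_mem_FP Brick.fstF_mem_FP
/-- `gA C ∈ FP`. [folklore] -/
theorem gA_mem_FP (C : ℕ) : gA C ∈ FP :=
  comp_mem_FP Brick.ltLenF_mem_FP (fanoutFn_mem_FP (mA_mem_FP C) lenBinF_uA_mem_FP)
/-- `XA C ∈ FP`. [folklore] -/
theorem XA_mem_FP (C : ℕ) : XA C ∈ FP :=
  fanoutFn_mem_FP Brick.fstF_mem_FP (fanoutFn_mem_FP (mA_mem_FP C) dA_mem_FP)
/-- `yA C ∈ FP`. [folklore] -/
theorem yA_mem_FP (C : ℕ) : yA C ∈ FP :=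
  comp_mem_FP unpad_mem_FP (comp_mem_FP ttFn_mem_FP (XA_mem_FP C))
/-- `vinA C ∈ FP`. [folklore] -/
theorem vinA_mem_FP (C : ℕ) : vinA C ∈ FP :=
  iteFn_mem_FP (gA_mem_FP C) (fanoutFn_mem_FP xA_mem_FP (yA_mem_FP C)) (const_mem_FP _)

/-- **The patch bit is in `FP`** when the patch consists of short words only (finitely many
exceptions are free, `mem_FP_of_eqOn_le`). [folklore] -/
theorem sA_mem_FP {N : ℕ} (hS : S ⊆ {x | x.length < N}) : sA S ∈ FP := by
  have h0 : (fun x : List Bool => [S.boolIndicator x]) ∈ FP := by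
    refine mem_FP_of_eqOn_le (const_mem_FP [false]) N fun z hz => ?_
    have : z ∉ S := fun h => absurd (hS h) (by simp; omega)
    rw [(Set.notMem_iff_boolIndicator _ _).1 this]
  exact comp_mem_FP h0 xA_mem_FP

/-- `preA C S ∈ FP` (short patch). [folklore] -/
theorem preA_mem_FP (C : ℕ) {N : ℕ} (hS : S ⊆ {x | x.length < N}) : preA C S ∈ FP :=
  fanoutFn_mem_FP (vinA_mem_FP C) (fanoutFn_mem_FP (gA_mem_FP C) (sA_mem_FP hS))

/-- `fstF ∘ sndF ∈ FP`. [folklore] -/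
theorem fstF_sndF_mem_FP : (Brick.fstF ∘ Brick.sndF) ∈ FP := comp_mem_FP Brick.fstF_mem_FP Brick.sndF_mem_FP
/-- `postA ∈ FP`. [folklore] -/
theorem postA_mem_FP : postA ∈ FP :=
  iteFn_mem_FP dA_mem_FP (const_mem_FP _) (Brick.andFn_mem_FP fstF_sndF_mem_FP Brick.fstF_mem_FP)

/-! Values on a genuine input `z = ⟨u, ⟨x, d⟩⟩`. -/

variable (u x d : List Bool)

/-- The genuine input. [folklore] -/
abbrev inA : List Bool := boolPair u (boolPair x d)

/-- Value of `uA` on a genuine input. [folklore] -/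
@[simp] theorem uA_inA : uA (inA u x d) = u := by simp [uA, inA, Brick.fstF]
/-- Value of `xA` on a genuine input. [folklore] -/
@[simp] theorem xA_inA : xA (inA u x d) = x := by simp [xA, inA, Brick.fstF, Brick.sndF]
/-- Value of `dA` on a genuine input. [folklore] -/
@[simp] theorem dA_inA : dA (inA u x d) = d := by simp [dA, inA, Brick.sndF]
/-- Value of `mA` on a genuine input. [folklore] -/
@[simp] theorem mA_inA (C : ℕ) : mA C (inA u x d) = ones (x.length + (C + 1)) := by
  simp only [mA, xA_inA, onesFn, OracleCompose.unaryEncodeNat_eq_replicate, ones,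
    List.replicate_append_replicate]

/-- **The guard tests `2ᵐ ≤ |u|`** (`m < |bin |u||` iff `2ᵐ ≤ |u|`, `Nat.lt_size`). [folklore] -/
@[simp] theorem gA_inA (C : ℕ) :
    gA C (inA u x d) = [decide (2 ^ (x.length + (C + 1)) ≤ u.length)] := by
  simp only [gA, Function.comp_apply, fanoutFn_apply, mA_inA, uA_inA, Brick.lenBinF_apply,
    Brick.ltLenF_boolPair, ones, List.length_replicate, TM2Pass.length_encodeNat_eq_size]
  simp only [Nat.lt_size]

/-- Value of `XA` on a genuine input. [folklore] -/
@[simp] theorem XA_inA (C : ℕ) :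
    XA C (inA u x d) = boolPair u (boolPair (ones (x.length + (C + 1))) d) := by
  simp only [XA, fanoutFn_apply, uA_inA, mA_inA, dA_inA]

/-- Under the guard the candidate witness is the payload of the table. [folklore] -/
theorem yA_inA (C : ℕ) (hg : 2 ^ (x.length + (C + 1)) ≤ u.length) :
    yA C (inA u x d) = unpad (ttOf (x.length + (C + 1)) d) := by
  simp only [yA, Function.comp_apply, XA_inA]
  rw [ttFn_apply]
  simp only [length_boolPair]
  omega

/-- Value of `sA` on a genuine input. [folklore] -/
@[simp] theorem sA_inA : sA S (inA u x d) = [S.boolIndicator x] := by simp [sA]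

/-- **The read-out on a genuine record.** [folklore] -/
theorem postA_apply (r g s : Bool) :
    postA (boolPair [r] (boolPair [g] [s])) = [s || (g && r)] := by
  have h1 : (Brick.sndF ∘ Brick.sndF) (boolPair [r] (boolPair [g] [s])) = [s] := by
    simp [Brick.sndF]
  have h2 : (Brick.fstF ∘ Brick.sndF) (boolPair [r] (boolPair [g] [s])) = [g] := by
    simp [Brick.fstF, Brick.sndF]
  have h3 : Brick.fstF (boolPair [r] (boolPair [g] [s])) = [r] := by simp [Brick.fstF]
  rw [postA, iteFn_apply h1]
  cases s
  · simp only [Bool.false_eq_true, ↓reduceIte, Bool.false_or]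
    rw [Brick.andFn_apply h2 h3]
  · rfl

variable {u x d}
variable {V : TM2ComputableAux Bool Bool}

/-- **The search language is in `P`** (short patch): the machine
`M_pre ∘ mapFstAux V ∘ M_post`, where the total verifier `V` is consulted on `⟨x, unpad (ttOf m d)⟩`
only under the guard `2ᵐ ≤ |u|` — so that its time `C·2^{|x|} + C + 2ᵐ` is linear in the input
length — and on the dummy `⟨ε, ε⟩` otherwise.
[cite: ImpagliazzoKabanetsWigderson2002, §3.1] [cite: AroraBarakCC2009, §1.3] -/
theorem searchLang_mem_P
    (hV : ∀ x y : List Bool, V.OutputsWithin (boolPair x y) (encodeBool (R x y))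
      (C * 2 ^ x.length + C + y.length))
    {N : ℕ} (hS : S ⊆ {x | x.length < N}) : SearchLang C R S ∈ Classes.P := by
  classical
  obtain ⟨pF, MF, hMF⟩ := preA_mem_FP C hS
  obtain ⟨pG, MG, hMG⟩ := postA_mem_FP
  set DF := TM2Comp.machinePushBound MF.tm with hDF
  set DV := TM2Comp.machinePushBound (mapFstAux V).tm with hDV
  let T₂ : Polynomial ℕ := Polynomial.C (C + 1) * X + Polynomial.C (2 * C + 9) +
    Polynomial.C 2 * (X + Polynomial.C DF * pF)
  refine mem_P_iff_holds.2 (polyTimeDecidable_iff.2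
    ⟨pF + T₂ + pG.comp (X + Polynomial.C DF * pF + Polynomial.C DV * T₂),
      MF.comp ((mapFstAux V).comp MG), fun z => ?_⟩)
  -- decompose the input as a genuine record (the fields are total functions)
  set u := uA z with hu
  set x := xA z with hx
  set d := dA z with hd
  set m := x.length + (C + 1) with hm
  -- stage 1
  have h₁ : MF.OutputsWithin z (preA C S z) (pF.eval z.length) := hMF z
  have hℓ₁ : (preA C S z).length ≤ z.length + DF * pF.eval z.length :=
    TM2Comp.length_le_of_outputsWithin MF h₁
  -- the verifier's input
  set g : Bool := decide (2 ^ m ≤ u.length) with hg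
  have hgA : gA C z = [g] := by
    have e : gA C z = [decide ((ones m).length < (encodeNat u.length).length)] := by
      simp only [gA, Function.comp_apply, fanoutFn_apply, Brick.ltLenF_boolPair, Brick.lenBinF_apply]
      simp only [mA, onesFn, OracleCompose.unaryEncodeNat_eq_replicate, ones,
        List.replicate_append_replicate]
      rfl
    rw [e, hg]
    simp only [ones, List.length_replicate, TM2Pass.length_encodeNat_eq_size, Nat.lt_size]
  obtain ⟨x', y', hvin, hgood, hbad⟩ : ∃ x' y' : List Bool, vinA C z = boolPair x' y' ∧
      (g = true → x' = x ∧ y' = unpad (ttOf m d)) ∧ (g = false → x' = [] ∧ y' = []) := by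
    rw [vinA, iteFn_apply hgA]
    cases hgb : g
    · exact ⟨[], [], rfl, fun h => absurd h (by simp), fun _ => ⟨rfl, rfl⟩⟩
    · refine ⟨x, unpad (ttOf m d), ?_, fun _ => ⟨rfl, rfl⟩, fun h => absurd h (by simp)⟩
      simp only [if_true, fanoutFn_apply, yA, Function.comp_apply, XA, fanoutFn_apply]
      rw [← hu, ← hx, ← hd]
      have hgu : 2 ^ m ≤ u.length := by simpa [hg] using hgb
      congr 1
      rw [show mA C z = ones m by
        simp only [mA, hx, hm, onesFn, OracleCompose.unaryEncodeNat_eq_replicate, ones,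
          List.replicate_append_replicate]]
      rw [ttFn_apply]
      simp only [length_boolPair]; omega
  have hpre : preA C S z = boolPair (boolPair x' y') (boolPair [g] [S.boolIndicator x]) := by
    rw [preA, fanoutFn_apply, hvin, fanoutFn_apply, hgA]
    rfl
  -- stage 2: the verifier
  have hz2 : 2 ≤ z.length ∨ z.length < 2 := le_or_gt 2 z.length
  have hux : 2 * u.length + x.length ≤ z.length := by
    have h1 := Brick.length_fstF_sndF_le z
    have h2 := Brick.length_fstF_sndF_le (Brick.sndF z)
    simp only [hu, hx, uA, xA, Function.comp_apply]
    omega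
  have hVt : C * 2 ^ x'.length + C + y'.length ≤ (C + 1) * z.length + C + C := by
    cases hgb : g
    · obtain ⟨rfl, rfl⟩ := hbad hgb
      simp only [List.length_nil, pow_zero, mul_one, add_zero]
      nlinarith
    · obtain ⟨rfl, rfl⟩ := hgood hgb
      have hgu : 2 ^ m ≤ u.length := by simpa [hg] using hgb
      have hxm : 2 ^ x.length ≤ 2 ^ m := Nat.pow_le_pow_right (by norm_num) (by omega)
      have hy : (unpad (ttOf m d)).length ≤ 2 ^ m :=
        (length_unpad_le _).trans (length_ttOf m d).le
      nlinarith
  have hV' : V.OutputsWithin (boolUnpair (preA C S z)).1 (encodeBool (R x' y'))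
      ((C + 1) * z.length + C + C) := by
    rw [hpre, boolUnpair_boolPair]
    exact (hV x' y').mono hVt
  have h₂ := outputsWithin_mapFstAux V hV'
  rw [hpre, readRest_boolPair, ← hpre] at h₂
  have e : encodeBool (R x' y') = [R x' y'] := by cases R x' y' <;> rfl
  rw [e] at h₂
  -- stage 3
  set mid := boolPair [R x' y'] (boolPair [g] [S.boolIndicator x]) with hmid
  have h₃ : MG.OutputsWithin mid (postA mid) (pG.eval mid.length) := hMG mid
  have hℓ₂ : mid.length ≤ (preA C S z).length + DV * ((C + 1) * z.length + C + C + 3 * [R x' y'].length +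
      2 * (preA C S z).length + 6) := TM2Comp.length_le_of_outputsWithin _ h₂
  -- the answer
  have hout : postA mid = encodeBool ((SearchLang C R S).boolIndicator z) := by
    rw [hmid, postA_apply]
    have hiff : z ∈ SearchLang C R S ↔ (S.boolIndicator x || (g && R x' y')) = true := by
      rw [mem_searchLang_iff]
      simp only [Bool.or_eq_true, Bool.and_eq_true, hg, decide_eq_true_eq]
      change (2 ^ m ≤ u.length ∧ R x (unpad (ttOf m d)) = true) ∨ x ∈ S ↔ _
      rw [← Set.mem_iff_boolIndicator, or_comm]
      constructor
      · rintro (hS' | ⟨hgu, hR⟩)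
        · exact Or.inl hS'
        · obtain ⟨rfl, rfl⟩ := hgood (by rw [hg]; exact decide_eq_true hgu)
          exact Or.inr ⟨hgu, hR⟩
      · rintro (hS' | ⟨hgu, hR⟩)
        · exact Or.inl hS'
        · obtain ⟨rfl, rfl⟩ := hgood (by rw [hg]; exact decide_eq_true hgu)
          exact Or.inr ⟨hgu, hR⟩
    by_cases hz : z ∈ SearchLang C R S
    · rw [(Set.mem_iff_boolIndicator _ _).1 hz, hiff.1 hz]; rfl
    · rw [(Set.notMem_iff_boolIndicator _ _).1 hz]
      have : (S.boolIndicator x || (g && R x' y')) = false := by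
        cases h : (S.boolIndicator x || (g && R x' y'))
        · rfl
        · exact absurd (hiff.2 h) hz
      rw [this]; rfl
  rw [hout] at h₃
  have h := Turing.TM2ComputableAux.comp_outputsWithin _ _ h₁
    (Turing.TM2ComputableAux.comp_outputsWithin _ _ h₂ h₃)
  refine h.mono ?_
  have hT₂ : (C + 1) * z.length + C + C + 3 * [R x' y'].length + 2 * (preA C S z).length + 6 ≤
      T₂.eval z.length := by
    simp only [T₂, eval_add, eval_mul, eval_C, eval_X, List.length_singleton]
    omega
  have hmid' : mid.length ≤ (X + Polynomial.C DF * pF + Polynomial.C DV * T₂).eval z.length := by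
    simp only [eval_add, eval_mul, eval_C, eval_X]
    exact hℓ₂.trans (Nat.add_le_add hℓ₁ (Nat.mul_le_mul_left _ hT₂))
  have m3 : pG.eval mid.length ≤
      (pG.comp (X + Polynomial.C DF * pF + Polynomial.C DV * T₂)).eval z.length := by
    rw [eval_comp]; exact natPoly_eval_mono _ hmid'
  simp only [id, eval_add] at m3 ⊢
  simp only [List.length_singleton] at hT₂ ⊢
  omega

/-! ### The easy-witness language is in `EXP` -/

/-- The certificate-length polynomial: `(m^D + 1)(8(m + m^D) + 10)` at `m = n + C + 1`. [folklore] -/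
noncomputable def descPoly (C D : ℕ) : Polynomial ℕ :=
  ((X + Polynomial.C (C + 1)) ^ D + 1) * (Polynomial.C 8 * ((X + Polynomial.C (C + 1)) +
    (X + Polynomial.C (C + 1)) ^ D) + Polynomial.C 10)

/-- Value of the certificate-length polynomial. [folklore] -/
theorem descPoly_eval (C D n : ℕ) :
    (descPoly C D).eval n = ((n + (C + 1)) ^ D + 1) * (8 * ((n + (C + 1)) + (n + (C + 1)) ^ D) + 10) := by
  simp [descPoly]

variable (C R S)

/-- **The easy-witness language** of exponent `D` with patch `S`: inputs `x` having a certificate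
`d` of polynomial length with `⟨x, d⟩` in the `lpad`-preimage of the search language — i.e.
(`mem_easyLang_iff`) the inputs that are `D`-easy by way of some description, or lie in `S`.
[cite: ImpagliazzoKabanetsWigderson2002, §3.1 (`f̂_{R,A,s}`)] -/
def EasyLang (D : ℕ) : Language Bool :=
  {x | ∃ d : List Bool, d.length ≤ (descPoly C D).eval x.length ∧
    boolPair x d ∈ lpad (C + 1) ⁻¹' SearchLang C R S}

variable {C R S}

/-- The pad is long enough for the guard: `2^{|x|+C+1} ≤ |first component of lpad (C+1) ⟨x, d⟩|`.
[folklore] -/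
theorem guard_lpad (x d : List Bool) :
    2 ^ (x.length + (C + 1)) ≤ (Brick.fstF (lpad (C + 1) (boolPair x d))).length := by
  simp only [lpad, Brick.fstF_boolPair, length_expPad, pow_one, List.length_replicate, length_boolPair]
  have : x.length + (C + 1) ≤ (C + 1) * (2 * x.length + 2 + d.length) := by nlinarith
  have := Nat.pow_le_pow_right (show 0 < 2 by norm_num) this
  omega

/-- **Membership in the padded search language.** [folklore] -/
theorem mem_preimage_searchLang_iff (x d : List Bool) :
    boolPair x d ∈ lpad (C + 1) ⁻¹' SearchLang C R S ↔
      R x (unpad (ttOf (x.length + (C + 1)) d)) = true ∨ x ∈ S := by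
  have hx : Brick.fstF (Brick.sndF (lpad (C + 1) (boolPair x d))) = x := by
    simp [lpad, Brick.fstF, Brick.sndF]
  have hd : Brick.sndF (Brick.sndF (lpad (C + 1) (boolPair x d))) = d := by
    simp [lpad, Brick.sndF]
  simp only [Set.mem_preimage, SearchLang, Set.mem_setOf_eq, hx, hd]
  constructor
  · rintro (⟨-, h⟩ | h)
    · exact Or.inl h
    · exact Or.inr h
  · rintro (h | h)
    · exact Or.inl ⟨guard_lpad x d, h⟩
    · exact Or.inr h

/-- Membership in the easy-witness language. [folklore] -/
theorem mem_easyLang_iff (D : ℕ) (x : List Bool) :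
    x ∈ EasyLang C R S D ↔ ∃ d : List Bool, d.length ≤ (descPoly C D).eval x.length ∧
      (R x (unpad (ttOf (x.length + (C + 1)) d)) = true ∨ x ∈ S) := by
  change (∃ d : List Bool, d.length ≤ (descPoly C D).eval x.length ∧
    boolPair x d ∈ lpad (C + 1) ⁻¹' SearchLang C R S) ↔ _
  simp only [mem_preimage_searchLang_iff]

/-- **The easy-witness language is in `EXP`**: a polynomially bounded existential
(`polyExists_EXP_subset_EXP`, exhaustive search over the descriptions) over the
`lpad`-preimage (`preimage_mem_EXP`, `lpad_mem_FE`: exponential padding computable in time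
`2^{O(n)}`) of the search language (`searchLang_mem_P`). This is the deterministic
`2^{poly(n)}`-time algorithm computing IKW's `f̂_{R,A,s}` for `s = m^D` ("enumerate all circuits `C`
of size `s`, check for each whether `R(x, tt(C))` holds").
[cite: ImpagliazzoKabanetsWigderson2002, §3.1] [cite: AroraBarakCC2009, Claim 2.4 (proof)] -/
theorem easyLang_mem_EXP
    (hV : ∀ x y : List Bool, V.OutputsWithin (boolPair x y) (encodeBool (R x y))
      (C * 2 ^ x.length + C + y.length))
    {N : ℕ} (hS : S ⊆ {x | x.length < N}) (D : ℕ) : EasyLang C R S D ∈ EXP :=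
  polyExists_EXP_subset_EXP ⟨lpad (C + 1) ⁻¹' SearchLang C R S,
    preimage_mem_EXP (lpad_mem_FE (C + 1)) (searchLang_mem_P hV hS), descPoly C D, fun _ => Iff.rfl⟩

variable {L : Language Bool}

/-- **If all long accepted inputs are `D`-easy then `L ∈ EXP`**: `L` is then the easy-witness
language of exponent `D` patched by its finitely many short members (certificates of easy inputs:
`exists_desc_of_easy`; soundness of the total verifier, `R x y → x ∈ L`, for the converse).
[cite: ImpagliazzoKabanetsWigderson2002, §3.1 ("If `f_R = f̂_{R,A,s}` … nontrivial deterministic algorithm")] -/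
theorem mem_EXP_of_eventually_easy
    (hV : ∀ x y : List Bool, V.OutputsWithin (boolPair x y) (encodeBool (R x y))
      (C * 2 ^ x.length + C + y.length))
    (hsound : ∀ x y : List Bool, R x y = true → x ∈ L) {D N : ℕ}
    (heasy : ∀ x ∈ L, N ≤ x.length → Easy R D (x.length + (C + 1)) x) : L ∈ EXP := by
  set S : Set (List Bool) := {x | x ∈ L ∧ x.length < N} with hS
  have hSN : S ⊆ {x | x.length < N} := fun x hx => hx.2
  have hL : L = EasyLang C R S D := by
    ext x
    rw [mem_easyLang_iff]
    constructor
    · intro hx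
      rcases lt_or_ge x.length N with hlt | hge
      · exact ⟨[], Nat.zero_le _, Or.inr ⟨hx, hlt⟩⟩
      · obtain ⟨d, hd, hR⟩ := exists_desc_of_easy (heasy x hx hge)
        exact ⟨d, by rw [descPoly_eval]; exact hd, Or.inl hR⟩
    · rintro ⟨d, -, hR | hxS⟩
      · exact hsound x _ hR
      · exact hxS.1
  rw [hL]
  exact easyLang_mem_EXP hV hSN D

/-- **Hard inputs at infinitely many lengths** (the input to the generator,
`hardIO_of_frequently_not_easy`): if `L ∉ EXP` then for every exponent `D` there are, at
infinitely many lengths `n`, accepted inputs of length `n` that are not `D`-easy at table size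
`n + C + 1`. [cite: ImpagliazzoKabanetsWigderson2002, Lemma 17 (proof: "for infinitely many `n` there exists … `zₙ`")] -/
theorem frequently_not_easy_of_not_mem_EXP
    (hV : ∀ x y : List Bool, V.OutputsWithin (boolPair x y) (encodeBool (R x y))
      (C * 2 ^ x.length + C + y.length))
    (hsound : ∀ x y : List Bool, R x y = true → x ∈ L) (hEXP : L ∉ EXP) (D : ℕ) :
    ∃ᶠ n in atTop, ∃ x ∈ L, x.length = n ∧ ¬ Easy R D (n + (C + 1)) x := by
  by_contra h
  rw [Filter.not_frequently, Filter.eventually_atTop] at h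
  obtain ⟨N, hN⟩ := h
  refine hEXP (mem_EXP_of_eventually_easy hV hsound (D := D) (N := N) fun x hx hNx => ?_)
  by_contra hne
  exact hN x.length hNx ⟨x, hx, rfl, hne⟩

end Search


end EasyWitness

open EasyWitness

/-! ### IKW Lemma 17 with Thm. 12 (2): Thm. 18 in the `MA` case -/

section Assembly

/-- **IKW Thm. 18 (`MA` case) for one language**: if `L ∈ NTIME(2ⁿ) ∖ EXP` then, given the
derandomization leaf `IKW2002_thm12_2`, `MA ⊆ io-[NTIME(2^{n^ε})/n^ε]` for every `ε > 0` — the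
total verifier of `L` (`exists_total_verifier_of_mem_NTIME_two_pow`), the hard inputs it must have
at infinitely many lengths for every exponent (`frequently_not_easy_of_not_mem_EXP`), the
easy-witness generator (`MA_subset_io_of_frequently_not_easy`).
[cite: ImpagliazzoKabanetsWigderson2002, Lemma 17 and Thm. 18] -/
theorem MA_subset_io_of_mem_NTIME_of_not_mem_EXP (h12 : IKW2002_thm12_2) {L : Language Bool}
    (hL : L ∈ NTIME (fun n => 2 ^ n)) (hEXP : L ∉ EXP) {ε : ℝ} (hε : 0 < ε) :
    MA ⊆ io (advice (NTIME fun n => 2 ^ ⌈(n : ℝ) ^ ε⌉₊) fun n => ⌈(n : ℝ) ^ ε⌉₊) := by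
  obtain ⟨C, R, V, hV, hmem, hsound⟩ := exists_total_verifier_of_mem_NTIME_two_pow hL
  exact MA_subset_io_of_frequently_not_easy h12 hV (fun x hx => (hmem x).1 hx)
    (frequently_not_easy_of_not_mem_EXP hV hsound hEXP) hε

/-- **`IKW2002_thm18_MA` from `IKW2002_thm12_2`** (IKW Thm. 18 in the `MA` case, proved from the
leaf Thm. 12 (2)): under `NEXP ≠ EXP` pick `L ∈ NEXP ∖ EXP` (`EXP ⊆ NEXP`, `EXP_subset_NEXP`), pad
it into `NTIME(2ⁿ)` (`padPre_mem_NTIME_two_pow`; still outside `EXP` by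
`mem_EXP_of_karpReducible` and `karpReducible_padPre` — "a simple padding argument"), and apply
Lemma 17 with Thm. 12 (2). This retires the leaf `IKW2002_thm18_MA` of `EasyWitness.lean` in favour
of `IKW2002_thm12_2` (`IKWGenerators.lean`).
[cite: ImpagliazzoKabanetsWigderson2002, Thm. 18 (proof)] [cite: AroraBarakCC2009, proof of Lemma 20.20 (p. 417)] -/
theorem IKW2002_thm18_MA_of_thm12_2 (h12 : IKW2002_thm12_2) : IKW2002_thm18_MA := by
  intro hne ε hε
  have hns : ¬ NEXP ⊆ EXP := fun h => hne (Set.Subset.antisymm h EXP_subset_NEXP)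
  obtain ⟨L, hLN, hLE⟩ := Set.not_subset.1 hns
  simp only [NEXP, Set.mem_iUnion] at hLN
  obtain ⟨k, hk⟩ := hLN
  have h1 : padPre k L ∈ NTIME (fun n => 2 ^ n) := padPre_mem_NTIME_two_pow hk
  have h2 : padPre k L ∉ EXP := fun h => hLE (mem_EXP_of_karpReducible (karpReducible_padPre k L) h)
  exact MA_subset_io_of_mem_NTIME_of_not_mem_EXP h12 h1 h2 hε

end Assembly

end Literature.Computability.Complexity
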